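import Summits.RiemannHypothesis.RiemannHypothesis.Theorems.CofiniteCriticalLine.Negative.KiKimLeeUniform
import Summits.RiemannHypothesis.RiemannHypothesis.Theorems.CofiniteCriticalLine.Negative.KiKimLeeEndpoint
import Literature.NumberTheory.LFunctions.KiKimLeeProofs
import Literature.NumberTheory.LFunctions.DeBruijnNewmanConstProofs
import HarnessLib

/-!
# Ki's uniform question lands on `CofiniteCriticalLine` (FOZ) — RAW zero-definition form

Cell rh-split, seat (dbn, bridge) gen 2 (planner-rh-split-dbn-bridge-g2-0); raw form of
`HOME/rh-split-dbn-bridge/SketchG2.lean` (ns `PubRhSplit.DbnBridgeG2`) with every Prop spelled out, so the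
file declares theorems only (no definitions / abbreviations / instances / notation, no `native_decide`).

H. Ki, *Zeros of zeta functions* (2011), printed p.104, after Thm 3.7 (= Ki–Kim–Lee): «It should be important
to ask if we can prove an uniform version of Theorem 3.7, i.e., the number of zeros of Ξ_λ(z) off the real axis
is finite uniformly for any λ > 0. Then, this directly implies that all but finitely many zeros of ζ(s) are on
the critical line.»  Here `Ξ_λ ↔ deBruijnH t`.

* `kiKimLee_at_zero_of_uniformNonrealCount` / `cofiniteCriticalLine_of_kiUniform` — KERNEL form of «directly
  implies»: a bound `M`, uniform in `t > 0`, on the number of non-real zeros of `H_t` gives a Ki–Kim–Lee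
  reality threshold for `H_0`, i.e. `CofiniteCriticalLine` (Hurwitz at `M+1` separated non-real zeros of `H_0`).
* `kiUniform_of_rh` — RH-implied (M = 0).  `kiUniform_of_cofinite` / `kiUniform_iff_cofinite` — converse
  MODULO the hypothesis `hmono`: count monotonicity of the non-real zeros under the flow in DISTINCT-zero currency
  (`Finset.card`) — RH-implied, OPEN.  ERRATUM (dbn-bridge g4, card §10): the classical multiplicity-count law
  (de Bruijn 1950 / Craven–Csordas 1994 / Ki–Kim–Lee 2009 §2) counts non-real zeros WITH multiplicity and yields
  `hmono` only together with simplicity of the non-real zeros; in distinct currency the class statement is false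
  (toy `e^{−tD²}(z²+1)²`); the faithfully typed multiplicity version is `Splittings/DbnBridgeKiUniformMult.lean`
  (`kiUniform_iff_cofinite_mult`).
* `cofinite_of_uniformThreshold`, `polyThreshold_of_uniformThreshold`, `polyThreshold_of_rh` — the threshold-law
  ladder: a `t`-uniform reality threshold gives FOZ and gives the polynomial law `K·t^{-A}` for every `A ≥ 0`.

Reading (lens (ii) of the splitting brief): Ki's question is RH-implied, not known RH-equivalent, in print —
and it reaches the ∃-tail `CofiniteCriticalLine`, never the fixed-height tail `DBN.DbnHighUniform`.

Referee label (rh-split-ref 19:46Z, card `cards/SPLIT-dbn-bridge.md` §8): «KiUniform ⟹ FOZ kernel, converse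
modulo NonrealCountMono; (dbn, bridge) EMPTY for TAIL(H) by theorem; zero-def shape PASS». Replays: referee farm
replay std 19:46Z; typer-2 g2 H1 replay 19:46Z (verbatim, rc 0 / 0 warnings / 0 sorry; `#print axioms
kiUniform_iff_cofinite` = [propext, Classical.choice, Quot.sound]). Filed by rh-split-typer-2 g2 per lead ruling
19:47Z (home: NEW `Theorems/Splittings/DbnBridgeKiUniform.lean`). Not a splitting, not a survivor.
SPLITTING SEARCH over kernel-typed RH-EQUIVALENCES; a splitting A ∧ B ⟹ RH is CONDITIONAL bookkeeping unless
A and B are both proved; nothing here bears on the truth of RH.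
-/

noncomputable section

open Complex Set Filter Metric Topology

-- tree convention (Splittings/*): inside this namespace the bare token `RiemannHypothesis` is the summit
-- namespace; Mathlib's statement is written `_root_.RiemannHypothesis`.
set_option linter.dupNamespace false

namespace Summit.RiemannHypothesis.RiemannHypothesis.Theorems.Splittings.DbnBridgeKiUniform

open Literature.NumberTheory.LFunctions
open Summit.RiemannHypothesis.RiemannHypothesis.Theses.RuelleBand
open Summit.RiemannHypothesis.Cruxes.CofiniteCriticalLine.Negative

/-! ## 1. Hurwitz near a zero of `H_0`, any radius -/

/-- Every zero `z₀` of `H_0` attracts zeros of `H_t`, `t → 0⁺`, into any prescribed ball (Hurwitz; the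
zeros of `H_0` are isolated, `eventually_ne_zero_deBruijnH`; `H_t → H_0` locally uniformly,
`tendstoUniformlyOn_deBruijnH`). [folklore] -/
theorem eventually_exists_zero_mem_ball {z₀ : ℂ} (hz₀ : deBruijnH 0 z₀ = 0) {ρ : ℝ} (hρ : 0 < ρ) :
    ∀ᶠ t in 𝓝[>] (0 : ℝ), ∃ z ∈ ball z₀ ρ, deBruijnH t z = 0 := by
  have hdiff : ∀ t, Differentiable ℂ (deBruijnH t) := differentiable_deBruijnH_holds
  obtain ⟨r₁, hr₁, hball⟩ :=
    Metric.eventually_nhds_iff_ball.1 (eventually_nhdsWithin_iff.1 (eventually_ne_zero_deBruijnH 0 z₀))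
  set r : ℝ := min (r₁ / 2) ρ with hr_def
  have hr : 0 < r := lt_min (by linarith) hρ
  have hr₁' : r < r₁ := lt_of_le_of_lt (min_le_left _ _) (by linarith)
  have hrρ : r ≤ ρ := min_le_right _ _
  have hunif : TendstoUniformlyOn (fun t : ℝ => deBruijnH t) (deBruijnH 0) (𝓝[>] (0 : ℝ))
      (closedBall z₀ r) :=
    fun u hu => nhdsWithin_le_nhds ((tendstoUniformlyOn_deBruijnH 0 z₀ r) u hu)
  have hF : ∀ᶠ t in 𝓝[>] (0 : ℝ), DiffContOnCl ℂ (deBruijnH t) (ball z₀ r) :=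
    Filter.Eventually.of_forall fun t => (hdiff t).diffContOnCl
  have hsphere : ∀ z ∈ sphere z₀ r, deBruijnH 0 z ≠ 0 := by
    intro z hz
    refine hball z (sphere_subset_closedBall.trans (closedBall_subset_ball hr₁') hz) ?_
    rw [mem_compl_singleton_iff]
    intro hzz
    have : dist z z₀ = r := mem_sphere.1 hz
    rw [hzz, dist_self] at this
    exact hr.ne this
  have hcont : ContinuousOn (deBruijnH 0) (sphere z₀ r) := (hdiff 0).continuous.continuousOn
  have hev := Complex.eventually_exists_zero_mem_ball_of_tendstoUniformlyOn hr hF hunif hcont hz₀ hsphere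
  exact hev.mono fun t ⟨z, hz, hz0⟩ => ⟨z, ball_subset_ball hrρ hz, hz0⟩

/-! ## 2. If Ki–Kim–Lee fails at `t = 0`, `H_0` has arbitrarily many SEPARATED non-real zeros -/

/-- No threshold at `t = 0` ⟹ for every `n` there are `n` non-real zeros of `H_0` whose real parts are
pairwise `≥ 1` apart. [folklore] -/
theorem exists_separated_nonreal_zeros
    (hno : ¬ ∃ T : ℝ, ∀ z : ℂ, deBruijnH 0 z = 0 → T ≤ |z.re| → z.im = 0) (n : ℕ) :
    ∃ S : Finset ℂ, S.card = n ∧ (∀ z ∈ S, deBruijnH 0 z = 0 ∧ z.im ≠ 0) ∧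
      (∀ z ∈ S, ∀ w ∈ S, z ≠ w → 1 ≤ |z.re - w.re|) := by
  have hno' : ∀ T : ℝ, ∃ z : ℂ, deBruijnH 0 z = 0 ∧ T ≤ |z.re| ∧ z.im ≠ 0 := by
    intro T
    by_contra hc
    push Not at hc
    exact hno ⟨T, fun z hz hT => hc z hz hT⟩
  induction n with
  | zero => exact ⟨∅, by simp, by simp, by simp⟩
  | succ n ih =>
    obtain ⟨S, hcard, hS, hsep⟩ := ih
    obtain ⟨z, hz0, hzT, hzim⟩ := hno' (∑ w ∈ S, (|w.re| + 1))
    have hbig : ∀ w ∈ S, |w.re| + 1 ≤ |z.re| := by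
      intro w hw
      have : |w.re| + 1 ≤ ∑ w ∈ S, (|w.re| + 1) :=
        Finset.single_le_sum (f := fun w : ℂ => |w.re| + 1) (fun v _ => by positivity) hw
      linarith
    have hz_notin : z ∉ S := by
      intro hz
      have := hbig z hz
      linarith
    refine ⟨Finset.cons z S hz_notin, ?_, ?_, ?_⟩
    · rw [Finset.card_cons, hcard]
    · intro v hv
      rcases Finset.mem_cons.1 hv with rfl | hv
      · exact ⟨hz0, hzim⟩
      · exact hS v hv
    · intro v hv w hw hvw
      rcases Finset.mem_cons.1 hv with rfl | hv'
      · have hw' : w ∈ S := by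
          rcases Finset.mem_cons.1 hw with rfl | hw'
          · exact absurd rfl hvw
          · exact hw'
        have h1 := hbig w hw'
        have h2 : |v.re| - |w.re| ≤ |v.re - w.re| := abs_sub_abs_le_abs_sub _ _
        linarith
      · rcases Finset.mem_cons.1 hw with rfl | hw'
        · have h1 := hbig v hv'
          have h2 : |w.re| - |v.re| ≤ |v.re - w.re| := by
            rw [abs_sub_comm v.re w.re]
            exact abs_sub_abs_le_abs_sub _ _
          linarith
        · exact hsep v hv' w hw' hvw

/-! ## 3. Ki's «directly implies», kernel form: a uniform count bound gives Ki–Kim–Lee at `t = 0`, i.e. FOZ -/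

/-- **a `t`-uniform count bound `M` ⟹ Ki–Kim–Lee at `t = 0`.** If `H_0` had no reality threshold, take `M + 1`
separated non-real zeros of `H_0` (§2); Hurwitz (§1) puts, for all small `t > 0`, a zero of `H_t` in the ball
of radius `min (1/2) (|Im z|/2)` about each — these balls are disjoint and miss the real axis — so `H_t` has
`M + 1` non-real zeros, contradicting the bound. [cite: Ki2011, p. 104] -/
theorem kiKimLee_at_zero_of_uniformNonrealCount {M : ℕ}
    (h : ∀ t : ℝ, 0 < t → ∀ S : Finset ℂ, (∀ z ∈ S, deBruijnH t z = 0 ∧ z.im ≠ 0) → S.card ≤ M) :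
    ∃ T : ℝ, ∀ z : ℂ, deBruijnH 0 z = 0 → T ≤ |z.re| → z.im = 0 := by
  by_contra hno
  obtain ⟨S, hcard, hS, hsep⟩ := exists_separated_nonreal_zeros hno (M + 1)
  have hρ : ∀ z ∈ S, 0 < min (1 / 2 : ℝ) (|z.im| / 2) := fun z hz =>
    lt_min (by norm_num) (by have := abs_pos.2 (hS z hz).2; linarith)
  have hev : ∀ z ∈ S, ∀ᶠ t in 𝓝[>] (0 : ℝ),
      ∃ w ∈ ball z (min (1 / 2 : ℝ) (|z.im| / 2)), deBruijnH t w = 0 :=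
    fun z hz => eventually_exists_zero_mem_ball (hS z hz).1 (hρ z hz)
  have hall : ∀ᶠ t in 𝓝[>] (0 : ℝ), ∀ z ∈ S,
      ∃ w ∈ ball z (min (1 / 2 : ℝ) (|z.im| / 2)), deBruijnH t w = 0 :=
    (Filter.eventually_all_finset S).2 hev
  have hpos : ∀ᶠ t in 𝓝[>] (0 : ℝ), 0 < t :=
    (eventually_mem_nhdsWithin (a := (0 : ℝ)) (s := Ioi 0)).mono fun t ht => ht
  obtain ⟨t, ht, hallt⟩ := (hpos.and hall).exists
  choose! w hw using hallt
  -- the selected zeros of `H_t` are pairwise distinct (disjoint balls) and non-real (balls miss the axis)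
  have hdist : ∀ z ∈ S, dist (w z) z < min (1 / 2 : ℝ) (|z.im| / 2) := fun z hz => mem_ball.1 (hw z hz).1
  have hinj : Set.InjOn w ↑S := by
    intro z hz v hv hzv
    by_contra hne
    have h1 : dist (w z) z < 1 / 2 := lt_of_lt_of_le (hdist z hz) (min_le_left _ _)
    have h2 : dist (w v) v < 1 / 2 := lt_of_lt_of_le (hdist v hv) (min_le_left _ _)
    have h3 : 1 ≤ |z.re - v.re| := hsep z hz v hv hne
    have h4 : |z.re - v.re| ≤ dist z v := by
      rw [dist_eq_norm]
      simpa using abs_re_le_norm (z - v)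
    have h5 : dist z v ≤ dist z (w z) + dist (w z) v := dist_triangle _ _ _
    rw [dist_comm z (w z), hzv] at h5
    rw [hzv] at h1
    linarith
  have hS' : ∀ u ∈ S.image w, deBruijnH t u = 0 ∧ u.im ≠ 0 := by
    intro u hu
    obtain ⟨z, hz, rfl⟩ := Finset.mem_image.1 hu
    refine ⟨(hw z hz).2, ?_⟩
    have h1 : dist (w z) z < |z.im| / 2 := lt_of_lt_of_le (hdist z hz) (min_le_right _ _)
    have h2 : |(w z).im - z.im| ≤ dist (w z) z := by
      rw [dist_eq_norm]
      simpa using abs_im_le_norm (w z - z)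
    intro him
    rw [him, zero_sub, abs_neg] at h2
    have := abs_nonneg z.im
    linarith
  have hle := h t ht (S.image w) hS'
  rw [Finset.card_image_of_injOn hinj, hcard] at hle
  omega

/-- **Ki's question lands on FOZ (kernel):** `KiUniform → CofiniteCriticalLine` (only finitely many zeros of
`ζ` off the critical line), via `cofiniteCriticalLine_iff_kiKimLee_at_zero`. [cite: Ki2011, p. 104] -/
theorem cofiniteCriticalLine_of_kiUniform
    (h : ∃ M : ℕ, ∀ t : ℝ, 0 < t → ∀ S : Finset ℂ, (∀ z ∈ S, deBruijnH t z = 0 ∧ z.im ≠ 0) → S.card ≤ M) :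
    CofiniteCriticalLine := by
  obtain ⟨M, hM⟩ := h
  exact cofiniteCriticalLine_iff_kiKimLee_at_zero.2 (kiKimLee_at_zero_of_uniformNonrealCount hM)

/-! ## 4. RH-implied; and the converse modulo de Bruijn's count monotonicity -/

/-- RH ⟹ the uniform count bound with `M = 0` (RH ⟺ `H_0` has only real zeros, `riemannHypothesis_iff_hasOnlyRealZeros_deBruijnH_zero_holds`;
then every `H_t`, `t ≥ 0`, has only real zeros, `mono_deBruijnH_holds`). [folklore] -/
theorem uniformNonrealCount_zero_of_rh (hRH : _root_.RiemannHypothesis) :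
    ∀ t : ℝ, 0 < t → ∀ S : Finset ℂ, (∀ z ∈ S, deBruijnH t z = 0 ∧ z.im ≠ 0) → S.card ≤ 0 := by
  intro t ht S hS
  have h0 : HasOnlyRealZeros (deBruijnH 0) := riemannHypothesis_iff_hasOnlyRealZeros_deBruijnH_zero_holds.1 hRH
  have hreal : HasOnlyRealZeros (deBruijnH t) := mono_deBruijnH_holds ht.le h0
  have hempty : S = ∅ := Finset.eq_empty_of_forall_notMem fun z hz => (hS z hz).2 (hreal z (hS z hz).1)
  simp [hempty]

/-- RH ⟹ Ki's uniform question. [folklore] -/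
theorem kiUniform_of_rh (hRH : _root_.RiemannHypothesis) :
    ∃ M : ℕ, ∀ t : ℝ, 0 < t → ∀ S : Finset ℂ, (∀ z ∈ S, deBruijnH t z = 0 ∧ z.im ≠ 0) → S.card ≤ M := ⟨0, uniformNonrealCount_zero_of_rh hRH⟩

/-- **FOZ ⟹ KiUniform, MODULO count monotonicity (`hmono`)** (hypothesis `hmono`: DISTINCT-zero count
monotonicity — RH-implied, open; the classical multiplicity-count law of de Bruijn 1950 / Craven–Csordas 1994 /
Ki–Kim–Lee 2009 yields it only together with simplicity of the non-real zeros — erratum dbn-bridge g4; see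
`DbnBridgeKiUniformMult.kiUniform_of_cofinite_mult` for the multiplicity currency): FOZ gives a
reality threshold `T` for `H_0` (`cofiniteCriticalLine_iff_kiKimLee_at_zero`), so the non-real zeros of `H_0`
sit in the finite set of zeros with `|Re z| < T` (`finite_setOf_deBruijnH_zero_abs_re_lt`); monotonicity
transports the bound to every `t > 0`. [cite: Ki2011, p. 104] -/
theorem kiUniform_of_cofinite
    (hmono : ∀ t t' : ℝ, 0 ≤ t → t ≤ t' → ∀ S' : Finset ℂ, (∀ z ∈ S', deBruijnH t' z = 0 ∧ z.im ≠ 0) →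
      ∃ S : Finset ℂ, (∀ z ∈ S, deBruijnH t z = 0 ∧ z.im ≠ 0) ∧ S'.card ≤ S.card)
    (h : CofiniteCriticalLine) :
    ∃ M : ℕ, ∀ t : ℝ, 0 < t → ∀ S : Finset ℂ, (∀ z ∈ S, deBruijnH t z = 0 ∧ z.im ≠ 0) → S.card ≤ M := by
  obtain ⟨T, hT⟩ := cofiniteCriticalLine_iff_kiKimLee_at_zero.1 h
  have hfin : {z : ℂ | deBruijnH 0 z = 0 ∧ z.im ≠ 0}.Finite :=
    (finite_setOf_deBruijnH_zero_abs_re_lt le_rfl T).subset fun z hz =>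
      ⟨hz.1, not_le.1 fun hle => hz.2 (hT z hz.1 hle)⟩
  refine ⟨hfin.toFinset.card, fun t ht S' hS' => ?_⟩
  obtain ⟨S, hS, hle⟩ := hmono 0 t le_rfl ht.le S' hS'
  have hsub : S ⊆ hfin.toFinset := fun z hz => hfin.mem_toFinset.2 (hS z hz)
  exact hle.trans (Finset.card_le_card hsub)

/-- Summary iff, modulo the DISTINCT-zero monotonicity hypothesis `hmono` (RH-implied, open — erratum dbn-bridge g4;
multiplicity currency: `DbnBridgeKiUniformMult.kiUniform_iff_cofinite_mult`): `KiUniform ↔ CofiniteCriticalLine`. -/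
theorem kiUniform_iff_cofinite
    (hmono : ∀ t t' : ℝ, 0 ≤ t → t ≤ t' → ∀ S' : Finset ℂ, (∀ z ∈ S', deBruijnH t' z = 0 ∧ z.im ≠ 0) →
      ∃ S : Finset ℂ, (∀ z ∈ S, deBruijnH t z = 0 ∧ z.im ≠ 0) ∧ S'.card ≤ S.card) :
    (∃ M : ℕ, ∀ t : ℝ, 0 < t → ∀ S : Finset ℂ, (∀ z ∈ S, deBruijnH t z = 0 ∧ z.im ≠ 0) → S.card ≤ M) ↔
      CofiniteCriticalLine :=
  ⟨cofiniteCriticalLine_of_kiUniform, kiUniform_of_cofinite hmono⟩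

/-! ## 5. R1 bookkeeping: the polynomial threshold law is RH-implied -/

/-- RH ⟹ the polynomial threshold law for all `K, A` (all zeros of every `H_t`, `t ≥ 0`, are real under RH). [folklore] -/
theorem polyThreshold_of_rh (hRH : _root_.RiemannHypothesis) (K A : ℝ) :
    ∀ t : ℝ, 0 < t → ∀ z : ℂ, deBruijnH t z = 0 → K * t ^ (-A) ≤ |z.re| → z.im = 0 := by
  intro t ht z hz _
  have h0 : HasOnlyRealZeros (deBruijnH 0) := riemannHypothesis_iff_hasOnlyRealZeros_deBruijnH_zero_holds.1 hRH
  exact mono_deBruijnH_holds ht.le h0 z hz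

/-! ## 6. Threshold-law ladder (kernel part): UNIFORM ⟹ FOZ and UNIFORM ⟹ POLYNOMIAL(every A) -/

/-- UNIFORM ⟹ FOZ (kernel; Hurwitz step `kiKimLee_at_zero_of_uniform` with `δ = 1`, then
`cofiniteCriticalLine_iff_kiKimLee_at_zero`). [folklore] -/
theorem cofinite_of_uniformThreshold {T : ℝ}
    (h : ∀ t : ℝ, 0 < t → ∀ z : ℂ, deBruijnH t z = 0 → T ≤ |z.re| → z.im = 0) : CofiniteCriticalLine :=
  cofiniteCriticalLine_iff_kiKimLee_at_zero.2
    ⟨T + 1, kiKimLee_at_zero_of_uniform one_pos fun t ht _ z hz hT => h t ht z hz hT⟩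

/-- UNIFORM ⟹ POLYNOMIAL for every exponent `A ≥ 0` (kernel): with `K = T·(1/2)^A` one has
`K·t^{-A} = T·(1/(2t))^A ≥ T` for `0 < t < 1/2`, and for `t ≥ 1/2` every zero of `H_t` is real anyway
(de Bruijn, `hasOnlyRealZeros_deBruijnH_one_half_holds` + `mono_deBruijnH_holds`). So the R1 object
`∃ K, (polynomial law with K, A)` sits AT OR BELOW the uniform law, whose strength is FOZ (previous theorem; converse
FOZ ⟹ UNIFORM is paper, modulo count monotonicity) — not near RH. [folklore] -/
theorem polyThreshold_of_uniformThreshold {T A : ℝ} (hT : 0 ≤ T) (hA : 0 ≤ A)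
    (h : ∀ t : ℝ, 0 < t → ∀ z : ℂ, deBruijnH t z = 0 → T ≤ |z.re| → z.im = 0) :
    ∀ t : ℝ, 0 < t → ∀ z : ℂ, deBruijnH t z = 0 → T * (1 / 2) ^ A * t ^ (-A) ≤ |z.re| → z.im = 0 := by
  intro t ht z hz hK
  rcases lt_or_ge t (1 / 2) with hlt | hge
  · apply h t ht z hz
    have hbase : (1 : ℝ) ≤ 1 / 2 * t⁻¹ := by
      rw [← div_eq_mul_inv, le_div_iff₀ ht]
      linarith
    have hpow : (1 : ℝ) ≤ (1 / 2 * t⁻¹) ^ A := Real.one_le_rpow hbase hA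
    have hsplit : (1 / 2 * t⁻¹ : ℝ) ^ A = (1 / 2) ^ A * t ^ (-A) := by
      rw [Real.mul_rpow (by norm_num) (inv_nonneg.2 ht.le), Real.rpow_neg ht.le, Real.inv_rpow ht.le]
    have hKT : T ≤ T * (1 / 2) ^ A * t ^ (-A) := by
      calc T = T * 1 := (mul_one T).symm
        _ ≤ T * ((1 / 2 * t⁻¹) ^ A) := mul_le_mul_of_nonneg_left hpow hT
        _ = T * (1 / 2) ^ A * t ^ (-A) := by rw [hsplit, mul_assoc]
    exact hKT.trans hK
  · exact mono_deBruijnH_holds hge hasOnlyRealZeros_deBruijnH_one_half_holds z hz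

end Summit.RiemannHypothesis.RiemannHypothesis.Theorems.Splittings.DbnBridgeKiUniform

end
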